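import Summits.RiemannHypothesis.RiemannHypothesis.Theorems.TiltedLandingLaw421R3BurgersRate
import Summits.RiemannHypothesis.RiemannHypothesis.Theorems.TiltedLandingLaw421R3ColumnImmunity
import Summits.RiemannHypothesis.RiemannHypothesis.Theorems.TiltedLandingLaw421R3WindowLoss
import Summits.RiemannHypothesis.RiemannHypothesis.Theorems.TiltedLandingLaw421R3JensenDipQuant

/-! # NESTED-SIGN KERNEL (lens-2 g3, RATE residual `RhW08.RateSplit.RateLawsHalfQ`, crux item stmt-RiemannHypothesis-33346)

The EXACT mechanism behind the two census facts «T-DISC(sep) < 1 on every separated charged far level» (instr-1: max 0.99998 / 24 732)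
and «T-DISC > 1 on touchers» (crit-1 CE1: 1.000105):

* §1 `im_mul_im_logDeriv_nonpos` — JENSEN SIGN LEMMA for a VALUE of the logarithmic derivative: `h` real entire of order `< 2`, `h w ≠ 0`, and `w`
  strictly outside the Jensen disc of every zero of `h` ⇒ `Im w · Im (h′/h)(w) ≤ 0` (the core of `Literature…jensen_circle`, for a non-zero value).
* §2 `im_mul_normSq_of_crit` — at a critical point of `G = q·h` (`q(w)·K = −2(w − a)`, `K = h′/h(w)`):
  `Im K · |q(w)|² = −2·Im w·(b² − ‖w − a‖²)`; hence `Im K ≤ 0 ⇒ NESTED` (`nested_of_im_nonpos`) and `0 < Im K ⇒ outside`.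
* §3 `exists_cofactor` — global pair removal: `G = pairQ (Re v) (Im v) · h` with `h` real entire of order `< 2` (two `dslope`s, `growth_dslope`).
* §4 `nested_of_jensenClear` — `f` real entire of order `< 2`, `v` a SIMPLE upper zero of `f⁽ʲ⁾`, `w` a moving upper critical point
  (`f⁽ʲ⁺¹⁾ w = 0`, `f⁽ʲ⁾ w ≠ 0`, `0 < Im w`) lying strictly outside the Jensen disc of every OTHER zero of `f⁽ʲ⁾` ⇒ `‖w − Re v‖ ≤ Im v` (nested).
* §5 `nested_of_separated` — the same with the route's binders: ISOLATION `|Re z − Re v| < R/2 ⇒ z ∈ {v, v̄}`, lens-1's SEPARATION clause C′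
  `Im v < Im z ⇒ Im v + Im z < |Re v − Re z|` (= `NoTallerToucher`), and LOCALISATION `‖w − v‖ ≤ d`, `d ≤ Im v`, `d + Im v < R/2`.
* §6 `nested_child_of_sep` — the `EngineHyps5` / `IsLowest` wrapper: R1a′ `FarChildExistsLawSep`'s disc conclusion is a THEOREM at simple lowest
  zeros once a moving upper child within `d` of `v` exists; i.e. R1a′ reduces to EXISTENCE + LOCALISATION (Rouché near `v`, tall regime) — the
  Jensen-disc part carries no law content.  (Multiple `v`: identical argument with `q^m`; not typed here.)

Tree facts used BY NAME: `Literature.Analysis.Complex.{exists_logDeriv_eq_sum_pair, logDeriv_apply_conj, im_mul_im_pair_nonpos, apply_conj_eq_conj,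
exists_ofReal_ne_zero, differentiable_iteratedDeriv_of_entire, im_iteratedDeriv_ofReal}`, `RhW08.IsolatedTilt.{pairQ, pairQ_eq_mul}`,
`RhW08.FarStep.{pairQ_re, pairQ_im}`, `RhW07.Law421.SuccessorCertificate.hasDerivAt_quadP`, `RhW08.Lens1Quant.growth_dslope`,
`RhW08.WindowLoss.realEntireLt2_iteratedDeriv`, `RhW08.Column.realEntireLt2_of_hyps`.
Nothing here bears on the truth of RH; RH is not proved; 33346 OPEN. -/

noncomputable section

open Complex Metric Set
open scoped ComplexConjugate
open Literature.Analysis.Complex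
open RhW08.IsolatedTilt
open Summit.RiemannHypothesis.RiemannHypothesis.Theorems.Splittings.JensenWindow (RealEntireLt2)

namespace RhW08.NestedSign

/-! ## §1 the Jensen sign lemma for a value of the logarithmic derivative -/

set_option maxHeartbeats 800000 in
/-- (K) **JENSEN SIGN LEMMA (value form).** `h` entire, `‖h‖ ≤ C e^{‖z‖^ρ}` (`0 ≤ ρ < 2`), real on `ℝ`, `h w ≠ 0`, and every zero `a` of `h` has `w`
strictly outside its Jensen disc (`|Im a| < ‖w − Re a‖`) ⇒ `Im w · Im (h′(w)/h(w)) ≤ 0`. -/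
theorem im_mul_im_logDeriv_nonpos {h : ℂ → ℂ} (hh : Differentiable ℂ h) {ρ C : ℝ} (hρ0 : 0 ≤ ρ) (hρ : ρ < 2)
    (hgr : ∀ z, ‖h z‖ ≤ C * Real.exp (‖z‖ ^ ρ)) (hreal : ∀ x : ℝ, (h x).im = 0) {w : ℂ} (hw : h w ≠ 0)
    (hout : ∀ a, h a = 0 → |a.im| < ‖w - a.re‖) : w.im * (deriv h w / h w).im ≤ 0 := by
  classical
  have hw' : h (conj w) ≠ 0 := by rw [apply_conj_eq_conj hh hreal, map_ne_zero]; exact hw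
  obtain ⟨c, hc⟩ := exists_ofReal_ne_zero hh ⟨w, hw⟩
  have key : ∀ ε : ℝ, 0 < ε → 2 * (w.im * (deriv h w / h w).im) ≤ |w.im| * ε := by
    intro ε hε
    obtain ⟨S, m, ψ₁, ψ₂, hS, -, h1, h2, hψ⟩ := exists_logDeriv_eq_sum_pair hh hρ0 hρ hgr hc hw hw' 0 hε
    rw [logDeriv_apply_conj hh hreal w] at h2
    have h2' : deriv h w / h w = ∑ a ∈ S, (m a : ℂ) / (w - conj a) + conj ψ₂ := by
      have := congrArg conj h2
      rw [Complex.conj_conj, map_add, map_sum] at this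
      rw [this]
      congr 1
      refine Finset.sum_congr rfl fun a _ ↦ ?_
      rw [map_div₀, map_natCast, map_sub, Complex.conj_conj]
    have hsum : ∑ a ∈ S, w.im * ((m a : ℂ) / (w - a) + (m a : ℂ) / (w - conj a)).im
        = w.im * ((deriv h w / h w).im + (deriv h w / h w).im - ψ₁.im + ψ₂.im) := by
      have e : ∑ a ∈ S, ((m a : ℂ) / (w - a) + (m a : ℂ) / (w - conj a)) =
          (deriv h w / h w) + (deriv h w / h w) - ψ₁ - conj ψ₂ := by
        rw [Finset.sum_add_distrib]
        have e1 : ∑ a ∈ S, (m a : ℂ) / (w - a) = deriv h w / h w - ψ₁ := by rw [h1]; ring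
        have e2 : ∑ a ∈ S, (m a : ℂ) / (w - conj a) = deriv h w / h w - conj ψ₂ := by rw [h2']; ring
        rw [e1, e2]; ring
      rw [← Finset.mul_sum, ← Complex.im_sum, e]
      simp only [Complex.sub_im, Complex.add_im, Complex.conj_im]
      ring
    have hle : ∑ a ∈ S, w.im * ((m a : ℂ) / (w - a) + (m a : ℂ) / (w - conj a)).im ≤ 0 :=
      Finset.sum_nonpos fun a ha ↦ im_mul_im_pair_nonpos (hout a (hS a ha).1) (m a)
    have hψim : |ψ₁.im - ψ₂.im| ≤ ε := by
      calc |ψ₁.im - ψ₂.im| = |(ψ₁ - ψ₂).im| := by rw [Complex.sub_im]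
        _ ≤ ‖ψ₁ - ψ₂‖ := Complex.abs_im_le_norm _
        _ ≤ ε := hψ
    have h3 : w.im * (ψ₁.im - ψ₂.im) ≤ |w.im| * ε := by
      calc w.im * (ψ₁.im - ψ₂.im) ≤ |w.im * (ψ₁.im - ψ₂.im)| := le_abs_self _
        _ = |w.im| * |ψ₁.im - ψ₂.im| := abs_mul _ _
        _ ≤ |w.im| * ε := mul_le_mul_of_nonneg_left hψim (abs_nonneg _)
    rw [hsum] at hle
    nlinarith [hle, h3]
  by_contra hpos
  push Not at hpos
  set t : ℝ := w.im * (deriv h w / h w).im with ht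
  have h1 := key (t / (|w.im| + 1)) (by positivity)
  have h2 : |w.im| * (t / (|w.im| + 1)) < t := by
    rw [← mul_div_assoc, div_lt_iff₀ (by positivity)]
    nlinarith [abs_nonneg w.im]
  linarith

/-! ## §2 the critical-point identity decides nested vs outside by the sign of `Im K` -/

/-- (K) at a critical point of `q·h` (`q = pairQ a b`, field `K`): `Im K · normSq (q w) = −2·Im w·(b² − ((Re w − a)² + Im w²))`. -/
theorem im_mul_normSq_of_crit {a b : ℝ} {w K : ℂ} (hb : b ≠ 0) (hcrit : pairQ a b w * K = -(2 * (w - a))) :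
    K.im * Complex.normSq (pairQ a b w) = -(2 * w.im * (b ^ 2 - ((w.re - a) ^ 2 + w.im ^ 2))) := by
  have hq : pairQ a b w ≠ 0 := by
    intro hq0
    have h' := hcrit
    rw [hq0, zero_mul] at h'
    have hwa : w = (a : ℂ) := by
      have h2 : (2 : ℂ) * (w - a) = 0 := by linear_combination h'
      rcases mul_eq_zero.1 h2 with h3 | h3
      · norm_num at h3
      · exact sub_eq_zero.1 h3
    rw [hwa, pairQ] at hq0
    have : ((b : ℂ)) ^ 2 = 0 := by simpa using hq0
    exact hb (by exact_mod_cast pow_eq_zero_iff (n := 2) (by norm_num) |>.1 this)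
  have hK : K = -(2 * (w - a)) / pairQ a b w := by
    rw [eq_div_iff hq]
    linear_combination hcrit
  have hns : Complex.normSq (pairQ a b w) ≠ 0 := by rwa [Ne, Complex.normSq_eq_zero]
  have hre : (-(2 * (w - (a : ℂ)))).re = -(2 * (w.re - a)) := by simp
  have him : (-(2 * (w - (a : ℂ)))).im = -(2 * w.im) := by simp
  rw [hK, Complex.div_im, hre, him, RhW08.FarStep.pairQ_re, RhW08.FarStep.pairQ_im]
  field_simp
  ring

/-- (K) `Im K ≤ 0` at an UPPER critical point ⇒ NESTED: `(Re w − a)² + Im w² ≤ b²`. -/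
theorem nested_of_im_nonpos {a b : ℝ} {w K : ℂ} (hb : b ≠ 0) (hcrit : pairQ a b w * K = -(2 * (w - a)))
    (hw : 0 < w.im) (hKim : K.im ≤ 0) : (w.re - a) ^ 2 + w.im ^ 2 ≤ b ^ 2 := by
  have hid := im_mul_normSq_of_crit hb hcrit
  have h0 : K.im * Complex.normSq (pairQ a b w) ≤ 0 :=
    mul_nonpos_of_nonpos_of_nonneg hKim (Complex.normSq_nonneg _)
  rw [hid] at h0
  nlinarith

/-- (K) `0 < Im K` at an UPPER critical point ⇒ strictly OUTSIDE the Jensen disc: `b² < (Re w − a)² + Im w²` (CE1's side). -/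
theorem outside_of_im_pos {a b : ℝ} {w K : ℂ} (hb : b ≠ 0) (hcrit : pairQ a b w * K = -(2 * (w - a)))
    (hw : 0 < w.im) (hKim : 0 < K.im) : b ^ 2 < (w.re - a) ^ 2 + w.im ^ 2 := by
  have hid := im_mul_normSq_of_crit hb hcrit
  have hq : pairQ a b w ≠ 0 := by
    intro hq0
    rw [hq0, zero_mul] at hcrit
    have hwa : w = (a : ℂ) := by
      have h2 : (2 : ℂ) * (w - a) = 0 := by linear_combination hcrit
      rcases mul_eq_zero.1 h2 with h3 | h3
      · norm_num at h3
      · exact sub_eq_zero.1 h3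
    have : w.im = 0 := by rw [hwa]; simp
    linarith
  have h0 : 0 < K.im * Complex.normSq (pairQ a b w) := mul_pos hKim (Complex.normSq_pos.2 hq)
  rw [hid] at h0
  nlinarith

/-! ## §3 global pair removal keeps the class -/

/-- (K) `G` real entire of order `< 2` with an upper zero `v` ⇒ `G = pairQ (Re v) (Im v) · h` with `h` real entire of order `< 2`. -/
theorem exists_cofactor {G : ℂ → ℂ} (hG : RealEntireLt2 G) {v : ℂ} (hv : G v = 0) (hv0 : v.im ≠ 0) :
    ∃ h : ℂ → ℂ, Differentiable ℂ h ∧ (∃ ρ C : ℝ, 0 ≤ ρ ∧ ρ < 2 ∧ ∀ z, ‖h z‖ ≤ C * Real.exp (‖z‖ ^ ρ)) ∧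
      (∀ x : ℝ, (h x).im = 0) ∧ ∀ z, G z = pairQ v.re v.im z * h z := by
  obtain ⟨ρ, C, hρ0, hρ, hgr⟩ := hG.growth
  obtain ⟨hd1, hfac1, hgr1⟩ := RhW08.Lens1Quant.growth_dslope hG.diff hρ0 hgr hv
  have hvbar : G (conj v) = 0 := by rw [apply_conj_eq_conj hG.diff hG.real, hv, map_zero]
  have hne : conj v - v ≠ 0 := by
    intro h0
    have := congrArg Complex.im h0
    simp at this
    exact hv0 (by linarith)
  have hr0 : dslope G v (conj v) = 0 := by
    have e := hfac1 (conj v)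
    rw [hvbar] at e
    exact (mul_eq_zero.1 e.symm).resolve_left hne
  obtain ⟨hd2, hfac2, hgr2⟩ := RhW08.Lens1Quant.growth_dslope hd1 hρ0 hgr1 hr0
  have e1 : ((v.re : ℂ) + (v.im : ℂ) * I) = v := Complex.re_add_im v
  have e2 : ((v.re : ℂ) - (v.im : ℂ) * I) = conj v := by
    apply Complex.ext <;> simp
  have hfacG : ∀ z, G z = pairQ v.re v.im z * dslope (dslope G v) (conj v) z := by
    intro z
    rw [pairQ_eq_mul, e1, e2, hfac1 z, hfac2 z]
    ring
  refine ⟨dslope (dslope G v) (conj v), hd2, ⟨ρ, _, hρ0, hρ, hgr2⟩, ?_, hfacG⟩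
  intro x
  have hqx : pairQ v.re v.im (x : ℂ) = (((x - v.re) ^ 2 + v.im ^ 2 : ℝ) : ℂ) := by
    simp only [pairQ]
    push_cast
    ring
  have hpos : 0 < (x - v.re) ^ 2 + v.im ^ 2 := by positivity
  have hq : pairQ v.re v.im (x : ℂ) ≠ 0 := by
    rw [hqx]; exact_mod_cast hpos.ne'
  have e : dslope (dslope G v) (conj v) (x : ℂ) = G x / pairQ v.re v.im x := by
    rw [eq_div_iff hq, hfacG x]
    ring
  rw [e, hqx, Complex.div_ofReal_im, hG.real x, zero_div]

/-! ## §4 the NESTED-CHILD THEOREM (Jensen-clear form) -/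

set_option maxHeartbeats 800000 in
/-- ★★ (K) **NESTED CHILD, Jensen-clear form.** `f` real entire of order `< 2`; `v` a SIMPLE upper zero of `f⁽ʲ⁾`; `w` a moving upper critical point
(`f⁽ʲ⁺¹⁾ w = 0`, `f⁽ʲ⁾ w ≠ 0`, `0 < Im w`) strictly outside the Jensen disc of every zero of `f⁽ʲ⁾` other than `v, v̄` ⇒ `‖w − Re v‖ ≤ Im v`. -/
theorem nested_of_jensenClear {f : ℂ → ℂ} (hf : RealEntireLt2 f) (j : ℕ) {v w : ℂ} (hv : iteratedDeriv j f v = 0) (hv0 : 0 < v.im)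
    (hsimp : iteratedDeriv (j + 1) f v ≠ 0) (hw : iteratedDeriv (j + 1) f w = 0) (hGw : iteratedDeriv j f w ≠ 0) (hw0 : 0 < w.im)
    (hout : ∀ z, iteratedDeriv j f z = 0 → z ≠ v → z ≠ conj v → |z.im| < ‖w - z.re‖) :
    ‖w - (v.re : ℂ)‖ ≤ v.im := by
  have hG : RealEntireLt2 (iteratedDeriv j f) := RhW08.WindowLoss.realEntireLt2_iteratedDeriv hf j
  obtain ⟨h, hhd, ⟨ρ, C, hρ0, hρ, hgr⟩, hreal, hfac⟩ := exists_cofactor hG hv hv0.ne'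
  have hderiv : ∀ z, deriv (iteratedDeriv j f) z = 2 * (z - v.re) * h z + pairQ v.re v.im z * deriv h z := by
    intro z
    have e : iteratedDeriv j f = pairQ v.re v.im * h := funext fun u => by rw [Pi.mul_apply]; exact hfac u
    have hq : HasDerivAt (pairQ v.re v.im) (2 * (z - v.re)) z :=
      RhW07.Law421.SuccessorCertificate.hasDerivAt_quadP v.re v.im z
    have hp := hq.mul (hhd z).hasDerivAt
    rw [e, hp.deriv]
  have hsucc : iteratedDeriv (j + 1) f = deriv (iteratedDeriv j f) := iteratedDeriv_succ
  have hqv : pairQ v.re v.im v = 0 := by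
    have e : v - (v.re : ℂ) = (v.im : ℂ) * I := by apply Complex.ext <;> simp
    rw [pairQ, e, mul_pow, Complex.I_sq]
    ring
  have hhv : h v ≠ 0 := by
    intro h0
    apply hsimp
    rw [hsucc, hderiv v, h0, hqv]
    simp
  have hhvbar : h (conj v) ≠ 0 := by rw [apply_conj_eq_conj hhd hreal, map_ne_zero]; exact hhv
  have hout' : ∀ z, h z = 0 → |z.im| < ‖w - z.re‖ := by
    intro z hz
    have hGz : iteratedDeriv j f z = 0 := by rw [hfac z, hz, mul_zero]
    refine hout z hGz ?_ ?_
    · rintro rfl; exact hhv hz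
    · rintro rfl; exact hhvbar hz
  have hhw : h w ≠ 0 := by
    intro h0; apply hGw; rw [hfac w, h0, mul_zero]
  have hcrit : pairQ v.re v.im w * (deriv h w / h w) = -(2 * (w - v.re)) := by
    have e : deriv (iteratedDeriv j f) w = 0 := by rw [← hsucc]; exact hw
    rw [hderiv w] at e
    field_simp
    linear_combination e
  have hsign := im_mul_im_logDeriv_nonpos hhd hρ0 hρ hgr hreal hhw hout'
  have hKim : (deriv h w / h w).im ≤ 0 := by
    by_contra hp
    push Not at hp
    have := mul_pos hw0 hp
    linarith
  have hsq := nested_of_im_nonpos hv0.ne' hcrit hw0 hKim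
  have e : ‖w - (v.re : ℂ)‖ ^ 2 = (w.re - v.re) ^ 2 + w.im ^ 2 := by
    rw [← Complex.normSq_eq_norm_sq, Complex.normSq_apply]; simp; ring
  exact (pow_le_pow_iff_left₀ (norm_nonneg _) hv0.le two_ne_zero).1 (by rw [e]; exact hsq)

/-! ## §5 the route's binders: isolation + lens-1 separation + localisation ⇒ nested -/

set_option maxHeartbeats 800000 in
/-- ★★★ (K) **SEPARATED ⇒ NESTED.** `f` real entire of order `< 2`; `v` a SIMPLE upper zero of `f⁽ʲ⁾`, ISOLATED (`|Re z − Re v| < R/2 ⇒ z ∈ {v, v̄}`)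
and SEPARATED from every strictly taller zero (`Im v < Im z ⇒ Im v + Im z < |Re v − Re z|`, lens-1's `NoTallerToucher`); `w` a moving upper
critical point within `d` of `v`, `d ≤ Im v`, `d + Im v < R/2` ⇒ NESTED: `‖w − Re v‖ ≤ Im v`.  (Separated levels of the census: T-DISC ≤ 1 is
a theorem for simple `v`; the touched CE1 escapes exactly through a taller zero whose Jensen disc contains the child.) -/
theorem nested_of_separated {f : ℂ → ℂ} (hf : RealEntireLt2 f) (j : ℕ) {v w : ℂ} {R d : ℝ} (hv : iteratedDeriv j f v = 0)
    (hv0 : 0 < v.im) (hsimp : iteratedDeriv (j + 1) f v ≠ 0) (hw : iteratedDeriv (j + 1) f w = 0) (hGw : iteratedDeriv j f w ≠ 0)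
    (hw0 : 0 < w.im) (hiso : ∀ z : ℂ, iteratedDeriv j f z = 0 → |z.re - v.re| < R / 2 → z = v ∨ z = conj v)
    (hsep : ∀ z : ℂ, iteratedDeriv j f z = 0 → v.im < z.im → v.im + z.im < |v.re - z.re|)
    (hloc : ‖w - v‖ ≤ d) (hd : d ≤ v.im) (hdR : d + v.im < R / 2) : ‖w - (v.re : ℂ)‖ ≤ v.im := by
  refine nested_of_jensenClear hf j hv hv0 hsimp hw hGw hw0 fun z hz hzv hzv' => ?_
  have hdiffj := differentiable_iteratedDeriv_of_entire hf.diff j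
  have hrealj := im_iteratedDeriv_ofReal hf.diff hf.real j
  have hfar : R / 2 ≤ |z.re - v.re| := by
    by_contra hlt
    push Not at hlt
    rcases hiso z hz hlt with h | h
    · exact hzv h
    · exact hzv' h
  have hwre : |w.re - v.re| ≤ d := by
    have := Complex.abs_re_le_norm (w - v)
    simp only [Complex.sub_re] at this
    exact this.trans hloc
  have hnorm : |w.re - z.re| ≤ ‖w - (z.re : ℂ)‖ := by
    have := Complex.abs_re_le_norm (w - (z.re : ℂ))
    simpa using this
  have htri : |z.re - v.re| - |w.re - v.re| ≤ |w.re - z.re| := by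
    have := abs_sub_abs_le_abs_sub (z.re - v.re) (w.re - v.re)
    rw [show z.re - v.re - (w.re - v.re) = z.re - w.re by ring, abs_sub_comm z.re w.re] at this
    exact this
  by_cases hzt : v.im < |z.im|
  · have hsep' : v.im + |z.im| < |v.re - z.re| := by
      rcases lt_or_ge 0 z.im with hzp | hzn
      · have := hsep z hz (by rwa [abs_of_pos hzp] at hzt)
        rwa [abs_of_pos hzp]
      · have hzc : iteratedDeriv j f (conj z) = 0 := by rw [apply_conj_eq_conj hdiffj hrealj, hz, map_zero]
        have hzim : (conj z).im = |z.im| := by rw [Complex.conj_im, abs_of_nonpos hzn]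
        have := hsep (conj z) hzc (by rw [hzim]; exact hzt)
        rwa [hzim, Complex.conj_re] at this
    rw [abs_sub_comm v.re z.re] at hsep'
    linarith
  · push Not at hzt
    linarith

/-! ## §6 the `EngineHyps5` / `IsLowest` wrapper (R1a′'s vocabulary) -/

open RhIdea5.G17.W07C9.Helpers RhIdea6.G18.W07C8.Law421BirthS RhIdea6.G19.W07C11.Seam RhW07.C12.FieldSplit RhW08.QuadW in
/-- ★★★ (K) **R1a′'s DISC CONCLUSION IS A THEOREM at simple lowest zeros, given a localised moving child.** In an `EngineHyps5 2` frame, at a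
lowest band state `v` of level `j` that is simple, isolated (`R/2`) and separated from every strictly taller zero of `f⁽ʲ⁾` (lens-1's C′), any
moving upper child `w` of `f⁽ʲ⁺¹⁾` within `d` of `v` (`d ≤ Im v`, `d + Im v < R/2`) is nested: `‖w − Re v‖ ≤ |Im v|`.  So `FarChildExistsLawSep`
(Glue2A-v3/v4a l.53) reduces, at simple `v`, to the EXISTENCE of such a localised moving child. -/
theorem nested_child_of_sep {η : ℝ} {f : ℂ → ℂ} {x₀ s hmax R Hs : ℝ} {B : ℕ} (hE : EngineHyps5 2 η f x₀ s hmax R Hs B)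
    {j : ℕ} {v w : ℂ} {d : ℝ} (hlow : IsLowest StTrkDQ η f x₀ s hmax R Hs B j v) (hsimp : iteratedDeriv (j + 1) f v ≠ 0)
    (hiso : ∀ z : ℂ, iteratedDeriv j f z = 0 → |z.re - v.re| < R / 2 → z = v ∨ z = conj v)
    (hsep : ∀ z : ℂ, iteratedDeriv j f z = 0 → v.im < z.im → v.im + z.im < |v.re - z.re|)
    (hw : iteratedDeriv (j + 1) f w = 0) (hGw : iteratedDeriv j f w ≠ 0) (hw0 : 0 < w.im)
    (hloc : ‖w - v‖ ≤ d) (hd : d ≤ v.im) (hdR : d + v.im < R / 2) : ‖w - (v.re : ℂ)‖ ≤ |v.im| := by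
  have hf : RealEntireLt2 f := RhW08.Column.realEntireLt2_of_hyps hE
  have hv : iteratedDeriv j f v = 0 := hlow.1.2.1
  have hv0 : 0 < v.im := hlow.1.2.2.1
  rw [abs_of_pos hv0]
  exact nested_of_separated hf j hv hv0 hsimp hw hGw hw0 hiso hsep hloc hd hdR

end RhW08.NestedSign
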